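import Summits.FinalStateConjecture.FinalStateConjecture.Theorems.DecoratedConeExhausts.Negative.ConeTubeSwallowsLateHalfSpace

/-!
# `DecoratedConeExhausts` is as strong as its one-hole, COVER-FREE version
# (negative lemma modulo `OneHoleObstruction` for item stmt-FinalStateConjecture-17671)

The crux `TangentConeAtIPlus.DecoratedConeExhausts` (K4) reads: for every admissible datum, every MGHD,
every cone data satisfying the shared predicate `Cone` and every hole data satisfying `Holes`, there is
an exhaustive, future-oriented, all-sub-extremal `FinalStateDecomposition` of `J⁺(ιΣ) ∩ I⁻(charted)`.
`Cone`'s only clause tying the flat-chart domain `U` to the late half-space is the covering clause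
`{y | T < y 0} \ ⋃ i, tube i 0 ⊆ U`, and `Negative/ConeTubeSwallowsLateHalfSpace.lean` shows it is
VOID: the drifted tube can be made the whole late half-space by editing `(σᵢ, drᵢ)` at rest times
`< T - 1` only, where no other clause looks.

Here this is pushed through the item itself, kernel-checked:

* `OneHoleCoverFree` — K4 specialised to ONE declared hole (`N = 1`, motion `(Λ, c)`) with the
  covering clause DELETED from `Cone` (and the vacuous one-hole disjointness / separation clauses
  dropped); every other clause is the route's, verbatim in one-hole form (`ConeOneCoverFree`,
  `HolesOne`).
* `oneHoleCoverFree_of_decoratedConeExhausts : DecoratedConeExhausts → OneHoleCoverFree` — given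
  cover-free one-hole data, feed K4 the worm profile (`cone_tube_clauses_of_worm` with `s₀ = T - 1`):
  the per-hole kinematic clauses transfer, the covering clause becomes trivial, and every remaining
  clause of `Cone`/`Holes` reads `σ, dr` only at rest times `≥ T - 1` (basin windows `|t - τ| < 1` with
  `τ ≥ T`, near regions `t > τ₀ ≥ T`, `atTop` limits), where the worm profile IS the given one; the
  conclusion does not mention the cone data at all.
* `decoratedConeExhausts_false_of_oneHoleObstruction : OneHoleObstruction → ¬ DecoratedConeExhausts`,
  `OneHoleObstruction := ¬ OneHoleCoverFree`: "some admissible MGHD carries one-hole cover-free cone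
  data and hole data — a flat chart on an ARBITRARY open `U` containing the agreement annuli, near-flat
  on `U`'s own slabs, weighted-flat where `U` happens to meet the interior cones (the weighted integrand
  is the zero-extension off `U`), plus one sub-extremal Kerr-settling near-zone chart — yet admits no
  exhaustive future-oriented all-sub-extremal decomposition". Such an MGHD (one honest settling hole plus
  ANY non-settling / extremal / singular content elsewhere) is not constructible in the tree (no
  `VacuumCauchyDevelopment.IsMaximal` beyond Minkowski), hence a negative lemma MODULO
  `OneHoleObstruction`, not a refutation. Repair recorded with the item: generate tube points only from
  rest times `≥ T`.

Everything is proved; the two `def`s are the one-hole predicates (verbatim clause text) and the two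
`Prop`s above.

## References

* M. Dafermos, J. Luk, arXiv:1710.01722, §1.2.1 (the N-black-hole final state picture). [folklore]
-/

noncomputable section

set_option linter.dupNamespace false

open Set Filter Topology TopologicalSpace
open scoped Manifold ContDiff Topology ENNReal

namespace Summit.FinalStateConjecture.FinalStateConjecture.Theorems.DecoratedConeExhausts.Negative

open Literature.Geometry.Lorentzian
open Summit.FinalStateConjecture.FinalStateConjecture.Theses.TangentConeAtIPlus (DecoratedConeExhausts)

/-- The route's `Cone` predicate for ONE declared hole with motion `(Λ, c)`, with the covering clause
`{y | T < y 0} \ tube 0 ⊆ U` DELETED (and the one-hole-vacuous disjointness clause dropped); all other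
clauses verbatim in one-hole form: orthochronous `Λ`, continuous sublinear `σ, dr` with `σ → ∞`, late
flat chart `Φ` on `U` into `J⁺(S)` with `Φ₊∂₀` future, weighted interior flatness (integrand
zero-extended off `U`), plain `C²` flatness on `U`'s slabs, the basin clause.
 [topic: Summits/FinalStateConjecture/FinalStateConjecture — route TangentConeAtIPlus, crux DecoratedConeExhausts] -/
def ConeOneCoverFree :=
  open Literature.Geometry.Lorentzian in open scoped ContDiff in fun (𝓢 : Spacetime.{0} 4) (S : Set 𝓢.carrier) (Λ : lorentzGroup) (c : E4) (σ : ℝ → ℝ) (dr : ℝ → E4) (T : ℝ) (U : Opens E4) (Φ : U → 𝓢.carrier) => let t := fun (x : E4) => poincareInv Λ c x 0; let d := fun (x : E4) => E4.spatialNorm (poincareInv Λ c x); let F := Minkowski.backgroundOn U; (Summit.FinalStateConjecture.IsOrthochronous Λ ∧ Continuous σ ∧ Continuous dr ∧ Tendsto (fun s : ℝ ↦ (|σ s| + ‖dr s‖) / s) atTop (𝓝 0) ∧ Tendsto σ atTop atTop) ∧ 𝓢.IsLateChart F (𝓢.metric.causalFuture 𝓢.timeOrientation S) T Φ ∧ (∀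 x : U, 𝓢.timeOrientation.IsFutureDirected (mfderiv 𝓘(ℝ, E4) (𝓡 4) Φ x (EuclideanSpace.single 0 1))) ∧ (∀ δ : ℝ, 0 < δ → Tendsto (fun τ : ℝ ↦ weightedCkSeminorm {x : E4 | x 0 = τ ∧ E4.spatialNorm x ≤ (1 - δ) * τ ∧ δ * τ ≤ d x} 2 0 (𝓢.deviationExtend F Φ)) atTop (𝓝 0)) ∧ Tendsto (fun τ : ℝ ↦ 𝓢.deviationCk F Φ 2 τ) atTop (𝓝 0) ∧ (∃ M a : ℝ, Kerr.IsSubextremal M a ∧ ∀ ε : ENNReal, 0 < ε → ∀ τ₁ : ℝ, ∃ τ : ℝ, τ₁ ≤ τ ∧ (let B := boostedKerrBackground Λ c M a; ∃ Ψ : B.domain → 𝓢.carrier, ContMDiff 𝓘(ℝ, E4) (𝓡 4) ∞ Ψ ∧ Topology.IsOpenEmbedding ({x : B.domain | |t x.1 - τ| < 1 ∧ d x.1 < σ (t x.1) + |a| + 6}.restrict Ψ) ∧ (∀ x : B.domain, |t x.1 - τ| < 1 → σ (t x.1) + 1 ≤ d x.1 → d x.1 < σ (t x.1) + 4 → ∃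 hx : x.1 + dr (t x.1) ∈ (U : Set E4), Ψ x = Φ ⟨_, hx⟩) ∧ 𝓢.truncDeviationCk B Ψ 2 (σ τ + 5) τ ≤ ε))

/-- The route's `Holes` predicate for ONE hole (the one-hole-vacuous separation clause dropped):
sub-extremal `(M, a)`, `T ≤ τ₀`, smooth `Ψ` open-embedding the near region `W` into `J⁺(S)`, `C²`
convergence on every fixed-radius slab and out to `σ + 5`, annulus agreement with `Φ ∘ shift`.
 [topic: Summits/FinalStateConjecture/FinalStateConjecture — route TangentConeAtIPlus, crux DecoratedConeExhausts] -/
def HolesOne :=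
  open Literature.Geometry.Lorentzian in open scoped ContDiff in fun (𝓢 : Spacetime.{0} 4) (S : Set 𝓢.carrier) (Λ : lorentzGroup) (c : E4) (σ : ℝ → ℝ) (dr : ℝ → E4) (T : ℝ) (U : Opens E4) (Φ : U → 𝓢.carrier) (M a : ℝ) (τ₀ : ℝ) => let B := boostedKerrBackground Λ c M a; fun (Ψ : B.domain → 𝓢.carrier) => let t := fun (x : E4) => poincareInv Λ c x 0; let d := fun (x : E4) => E4.spatialNorm (poincareInv Λ c x); let W := {x : B.domain | τ₀ < t x.1 ∧ d x.1 < σ (t x.1) + |a| + 6}; Kerr.IsSubextremal M a ∧ T ≤ τ₀ ∧ (ContMDiff 𝓘(ℝ, E4) (𝓡 4) ∞ Ψ ∧ Topology.IsOpenEmbedding (W.restrict Ψ) ∧ Ψ '' W ⊆ 𝓢.metric.causalFuture 𝓢.timeOrientation S) ∧ (∀ r : ℝ, Tendsto (fun τ : ℝ ↦ 𝓢.truncDeviationCk B Ψ 2 r τ) atTop (𝓝 0)) ∧ Tendsto (fun τ : ℝ ↦ 𝓢.truncDeviationCk B Ψ 2 (σ τ + 5) τ) atTop (𝓝 0) ∧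 (∀ x : B.domain, τ₀ < t x.1 → σ (t x.1) + 1 ≤ d x.1 → d x.1 < σ (t x.1) + 4 → T + 1 < (x.1 + dr (t x.1)) 0 → ∃ hx : x.1 + dr (t x.1) ∈ (U : Set E4), Ψ x = Φ ⟨_, hx⟩)

/-- **One-hole, cover-free K4**: `DecoratedConeExhausts` with `N = 1` and the covering clause of
`Cone` deleted — same conclusion (an exhaustive, future-oriented, all-sub-extremal
`FinalStateDecomposition` of `J⁺(ιΣ) ∩ I⁻(charted)`).
 [topic: Summits/FinalStateConjecture/FinalStateConjecture — route TangentConeAtIPlus, crux DecoratedConeExhausts] -/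
def OneHoleCoverFree : Prop :=
  ∀ (X : Type) [TopologicalSpace X] [ChartedSpace E3 X] [IsManifold (𝓡 3) ∞ X] [T2Space X]
    [SecondCountableTopology X] [ConnectedSpace X] (D : InitialDataSet (𝓡 3) X),
    D ∈ admissibleVacuumData X → ∀ 𝒟 : VacuumCauchyDevelopment D, 𝒟.IsMaximal →
    ∀ (Λ : lorentzGroup) (c : E4) (σ : ℝ → ℝ) (dr : ℝ → E4) (T : ℝ) (U : Opens E4)
      (Φ : U → 𝒟.carrier), ConeOneCoverFree 𝒟.toSpacetime (range 𝒟.embed) Λ c σ dr T U Φ →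
    ∀ (M a τ₀ : ℝ) (Ψ : (boostedKerrBackground Λ c M a).domain → 𝒟.carrier),
      HolesOne 𝒟.toSpacetime (range 𝒟.embed) Λ c σ dr T U Φ M a τ₀ Ψ →
    ∃ (O : Set 𝒟.carrier) (fd : FinalStateDecomposition 𝒟.toSpacetime O 2),
      (∀ i, Kerr.IsSubextremal (fd.mass i) (fd.spin i)) ∧
        O = Summit.FinalStateConjecture.exteriorOf 𝒟.toCauchyDevelopment fd.charted ∧
          Summit.FinalStateConjecture.HasExhaustiveCharts fd ∧
            Summit.FinalStateConjecture.IsFutureOriented fd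

/-- **The obstruction `H`**: NOT every admissible MGHD carrying one-hole cover-free cone data and hole
data admits an exhaustive, future-oriented, all-sub-extremal decomposition — i.e. some admissible MGHD
contains one sub-extremal Kerr-settling near zone (with a flat chart near its agreement annuli) but does
NOT settle down globally to finitely many sub-extremal Kerr black holes plus radiation in the exhaustive
sense. Not constructible in the tree (no maximal vacuum Cauchy development beyond Minkowski).
 [topic: Summits/FinalStateConjecture/FinalStateConjecture — route TangentConeAtIPlus, crux DecoratedConeExhausts] -/
def OneHoleObstruction : Prop :=
  ¬ OneHoleCoverFree

/-- **K4 implies its one-hole cover-free version.** Given cover-free one-hole data, feed K4 the worm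
profile of `Negative/ConeTubeSwallowsLateHalfSpace.lean` (agreeing with `(σ, dr)` on `[T - 1, ∞)`):
the covering clause is then trivial and every other clause is read at rest times `≥ T - 1` only. [folklore] -/
theorem oneHoleCoverFree_of_decoratedConeExhausts (h : DecoratedConeExhausts) : OneHoleCoverFree := by
  intro X _ _ _ _ _ _ D hD 𝒟 h𝒟 Λ c σ dr T U Φ hcone M a τ₀ Ψ hholes
  obtain ⟨⟨hortho, hσc, hdrc, hsubl, hσtop⟩, hlate, hfut, hweighted, hwave, hbasin⟩ := hcone
  obtain ⟨hsub, hTτ, hΨ, hconv, hconv5, hagree⟩ := hholes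
  -- the worm profile, equal to `(σ, dr)` on `[T - 1, ∞)`
  obtain ⟨σ', dr', heq, ⟨hσ'c, hdr'c, hsubl', hσ'top⟩, -, hcov⟩ :=
    cone_tube_clauses_of_worm Λ c hσc hdrc hsubl hσtop (T - 1) T
  have hσ' : ∀ s, T - 1 ≤ s → σ' s = σ s := fun s hs ↦ (heq s hs).1
  have hdr' : ∀ s, T - 1 ≤ s → dr' s = dr s := fun s hs ↦ (heq s hs).2
  -- K4 with `N = 1`, motion `(Λ, c)`, profile `(σ', dr')`, the same `T, U, Φ` and hole data
  refine h X D hD 𝒟 h𝒟 1 (fun _ ↦ (Λ, c)) (fun _ ↦ σ') (fun _ ↦ dr') T U Φ ?_ (fun _ ↦ M) (fun _ ↦ a)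
    τ₀ (fun _ ↦ Ψ) ?_
  · -- `Cone` for the worm data
    refine ⟨fun _ ↦ ⟨hortho, hσ'c, hdr'c, hsubl', hσ'top⟩,
      fun i j hij ↦ absurd (Subsingleton.elim i j) hij, ?_, hlate, hfut, fun δ hδ ↦ ?_, hwave,
      fun _ ↦ ?_⟩
    · -- the covering clause: void by the worm
      show {y : E4 | T < y 0} \ (⋃ _ : Fin 1, (fun x : E4 ↦ x + dr' (poincareInv Λ c x 0)) ''
            {x : E4 | E4.spatialNorm (poincareInv Λ c x) ≤ σ' (poincareInv Λ c x 0) + 0} ∩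
          {y : E4 | T < y 0}) ⊆ (U : Set E4)
      rw [Set.iUnion_const]
      exact hcov U
    · -- the weighted interior clause: `∀ i : Fin 1` is no restriction
      show Tendsto (fun τ : ℝ ↦ weightedCkSeminorm {x : E4 | x 0 = τ ∧
          E4.spatialNorm x ≤ (1 - δ) * τ ∧ ∀ _ : Fin 1, δ * τ ≤ E4.spatialNorm (poincareInv Λ c x)}
          2 0 (𝒟.toSpacetime.deviationExtend (Minkowski.backgroundOn U) Φ)) atTop (𝓝 0)
      have hset : ∀ τ : ℝ, {x : E4 | x 0 = τ ∧ E4.spatialNorm x ≤ (1 - δ) * τ ∧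
          ∀ _ : Fin 1, δ * τ ≤ E4.spatialNorm (poincareInv Λ c x)} = {x : E4 | x 0 = τ ∧
          E4.spatialNorm x ≤ (1 - δ) * τ ∧ δ * τ ≤ E4.spatialNorm (poincareInv Λ c x)} :=
        fun τ ↦ Set.ext fun x ↦ by simp
      simp_rw [hset]
      exact hweighted δ hδ
    · -- the basin clause, read at rest times `> τ - 1 ≥ T - 1`
      obtain ⟨M₁, a₁, hsub₁, hb⟩ := hbasin
      refine ⟨M₁, a₁, hsub₁, fun ε hε τ₁ ↦ ?_⟩
      obtain ⟨τ, hτ, Ψb, hΨb, hemb, hagr, hdev⟩ := hb ε hε (max τ₁ T)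
      have hτT : T ≤ τ := (le_max_right _ _).trans hτ
      refine ⟨τ, (le_max_left _ _).trans hτ, Ψb, hΨb, ?_, ?_, ?_⟩
      · have hS : {x : (boostedKerrBackground Λ c M₁ a₁).domain |
            |poincareInv Λ c x.1 0 - τ| < 1 ∧ E4.spatialNorm (poincareInv Λ c x.1) <
              σ' (poincareInv Λ c x.1 0) + |a₁| + 6} =
            {x : (boostedKerrBackground Λ c M₁ a₁).domain |
            |poincareInv Λ c x.1 0 - τ| < 1 ∧ E4.spatialNorm (poincareInv Λ c x.1) <
              σ (poincareInv Λ c x.1 0) + |a₁| + 6} := by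
          ext x
          simp only [Set.mem_setOf_eq]
          constructor
          · rintro ⟨h1, h2⟩
            rw [hσ' _ (by have := (abs_lt.mp h1).1; linarith)] at h2
            exact ⟨h1, h2⟩
          · rintro ⟨h1, h2⟩
            rw [← hσ' _ (by have := (abs_lt.mp h1).1; linarith)] at h2
            exact ⟨h1, h2⟩
        show Topology.IsOpenEmbedding ({x : (boostedKerrBackground Λ c M₁ a₁).domain |
            |poincareInv Λ c x.1 0 - τ| < 1 ∧ E4.spatialNorm (poincareInv Λ c x.1) <
              σ' (poincareInv Λ c x.1 0) + |a₁| + 6}.restrict Ψb)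
        rw [hS]
        exact hemb
      · intro x h1 h2 h3
        have ht : T - 1 ≤ poincareInv Λ c x.1 0 := by have := (abs_lt.mp h1).1; linarith
        change σ' (poincareInv Λ c x.1 0) + 1 ≤ E4.spatialNorm (poincareInv Λ c x.1) at h2
        change E4.spatialNorm (poincareInv Λ c x.1) < σ' (poincareInv Λ c x.1 0) + 4 at h3
        rw [hσ' _ ht] at h2 h3
        obtain ⟨hx, hx'⟩ := hagr x h1 h2 h3
        have hx₂ : x.1 + dr' (poincareInv Λ c x.1 0) ∈ (U : Set E4) := by rw [hdr' _ ht]; exact hx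
        refine ⟨hx₂, ?_⟩
        have hpt : (⟨x.1 + dr' (poincareInv Λ c x.1 0), hx₂⟩ : U) =
            ⟨x.1 + dr (poincareInv Λ c x.1 0), hx⟩ := Subtype.ext (by simp [hdr' _ ht])
        show Ψb x = Φ ⟨x.1 + dr' (poincareInv Λ c x.1 0), hx₂⟩
        rw [hpt]
        exact hx'
      · show 𝒟.toSpacetime.truncDeviationCk (boostedKerrBackground Λ c M₁ a₁) Ψb 2 (σ' τ + 5) τ ≤ ε
        rw [hσ' τ (by linarith)]
        exact hdev
  · -- `Holes` for the worm data (near region read at rest times `> τ₀ ≥ T`)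
    refine ⟨fun _ ↦ hsub, hTτ, fun _ ↦ ?_, fun _ r ↦ hconv r, fun _ ↦ ?_, fun _ x h1 h2 h3 h4 ↦ ?_,
      fun _ ↦ ⟨0, Subsingleton.pairwise⟩⟩
    · have hW : {x : (boostedKerrBackground Λ c M a).domain |
          τ₀ < poincareInv Λ c x.1 0 ∧ E4.spatialNorm (poincareInv Λ c x.1) <
            σ' (poincareInv Λ c x.1 0) + |a| + 6} =
          {x : (boostedKerrBackground Λ c M a).domain |
          τ₀ < poincareInv Λ c x.1 0 ∧ E4.spatialNorm (poincareInv Λ c x.1) <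
            σ (poincareInv Λ c x.1 0) + |a| + 6} := by
        ext x
        simp only [Set.mem_setOf_eq]
        constructor
        · rintro ⟨h1, h2⟩
          rw [hσ' _ (by linarith)] at h2
          exact ⟨h1, h2⟩
        · rintro ⟨h1, h2⟩
          rw [← hσ' _ (by linarith)] at h2
          exact ⟨h1, h2⟩
      show ContMDiff 𝓘(ℝ, E4) (𝓡 4) ∞ Ψ ∧ Topology.IsOpenEmbedding
          ({x : (boostedKerrBackground Λ c M a).domain | τ₀ < poincareInv Λ c x.1 0 ∧
            E4.spatialNorm (poincareInv Λ c x.1) < σ' (poincareInv Λ c x.1 0) + |a| + 6}.restrict Ψ) ∧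
          Ψ '' {x : (boostedKerrBackground Λ c M a).domain | τ₀ < poincareInv Λ c x.1 0 ∧
            E4.spatialNorm (poincareInv Λ c x.1) < σ' (poincareInv Λ c x.1 0) + |a| + 6} ⊆
            𝒟.toSpacetime.metric.causalFuture 𝒟.toSpacetime.timeOrientation (range 𝒟.embed)
      rw [hW]
      exact hΨ
    · show Tendsto (fun τ : ℝ ↦ 𝒟.toSpacetime.truncDeviationCk (boostedKerrBackground Λ c M a) Ψ 2
        (σ' τ + 5) τ) atTop (𝓝 0)
      exact hconv5.congr' ((eventually_ge_atTop T).mono fun τ hτ ↦ by simp only [hσ' τ (by linarith)])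
    · have ht : T - 1 ≤ poincareInv Λ c x.1 0 := by
        change τ₀ < poincareInv Λ c x.1 0 at h1
        linarith
      change σ' (poincareInv Λ c x.1 0) + 1 ≤ E4.spatialNorm (poincareInv Λ c x.1) at h2
      change E4.spatialNorm (poincareInv Λ c x.1) < σ' (poincareInv Λ c x.1 0) + 4 at h3
      change T + 1 < (x.1 + dr' (poincareInv Λ c x.1 0)) 0 at h4
      rw [hσ' _ ht] at h2 h3
      rw [hdr' _ ht] at h4
      obtain ⟨hx, hx'⟩ := hagree x h1 h2 h3 h4
      have hx₂ : x.1 + dr' (poincareInv Λ c x.1 0) ∈ (U : Set E4) := by rw [hdr' _ ht]; exact hx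
      refine ⟨hx₂, ?_⟩
      have hpt : (⟨x.1 + dr' (poincareInv Λ c x.1 0), hx₂⟩ : U) =
          ⟨x.1 + dr (poincareInv Λ c x.1 0), hx⟩ := Subtype.ext (by simp [hdr' _ ht])
      show Ψ x = Φ ⟨x.1 + dr' (poincareInv Λ c x.1 0), hx₂⟩
      rw [hpt]
      exact hx'

/-- **Negative lemma modulo `OneHoleObstruction`.** If some admissible MGHD carries one-hole cover-free
cone + hole data without admitting an exhaustive future-oriented all-sub-extremal decomposition, then
`DecoratedConeExhausts` is false. [folklore] -/
theorem decoratedConeExhausts_false_of_oneHoleObstruction (hH : OneHoleObstruction) :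
    ¬ DecoratedConeExhausts :=
  fun h ↦ hH (oneHoleCoverFree_of_decoratedConeExhausts h)

end Summit.FinalStateConjecture.FinalStateConjecture.Theorems.DecoratedConeExhausts.Negative

end
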